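/-
Copyright (c) 2026 the pub-hodgecm-mathlib formalisation cell (harness21).  Prover seat hodgecm-mathlib-F0P3b-p01 (g25); E1 keeper ∕ dealer F0P3a-p03 (g29), E1 BRICK
LEDGER row 27 «COMPACT-PICTURE JET @ DATUM», input (β) «HEIGHT» (census `F0/P2/p02/g25/jet/CENSUS-JET-AT-DATUM.v1` 35cdd4c6 §(β)∕§5; keeper ruling 2026-09-03T01:14:52Z).
-/
import Literature.NumberTheory.Automorphic.UnitaryGroupCMLocalIwasawa      -- ★ `exists_borel_mul_mem_cmLocalIntegralLevel` (`G = B·K_v`, every `N`, every finite `v`)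
import Literature.NumberTheory.Automorphic.CMPrincipalSeriesSpherical       -- ★ `proj_mem_cmLocalIntegralLevel`, ★ `v_torusEntry_eq_one_of_mem_cmLocalIntegralLevel`
import Literature.NumberTheory.Automorphic.LocalUnitaryIntegralLevel        -- ★ `isCompact_isOpen_cmLocalIntegralLevel`
import Literature.GroupTheory.AdditiveHeightOfDecomposition                 -- FILE H1 (this seat): `exists_height_of_mul_decomposition_of_isOpen`, `height_unique_of_mul_decomposition`
import HarnessLib

/-!
# The Iwasawa HEIGHT at the CM datum: `Λ : U(Φ_N)(L⁺_v) → A`, `Λ(b g) = λ(proj b) + Λ(g)`, right-`K_v`-invariant, `Λ|_{K_v} = 0`, locally constant —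
# for EVERY additive `λ` on the diagonal torus killed by `T ∩ K_v`, at EVERY finite place `v` (split ∕ inert ∕ ramified ∕ dyadic); the `ord_w`-instances

Cell `pub/hodgecm-mathlib`, crux H413 = `stmt-HodgeConjecture-24833` (`--supports` lane, helper, THEOREMS ONLY: no definition ∕ instance ∕ notation ∕ named fact ∕ `sorry`).
Namespace `Summit.HodgeConjecture.HodgeConjecture.Cruxes.H413.F0P3cStCharTSHeightAtDatum`.  E1 BRICK LEDGER (F0P3a-p03 (g29)) row 27, input (β) of census
«JET @ DATUM» v1 (F0P2-p02 (g25)): the ONE datum input that ★ J1 `SmoothInductionUnipotentModelJet` (p853-series, F0P2-p02 (g25)) and its datum dress J2 leave as a HYPOTHESIS —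
the letters `(Λ, hΛ : Λ (h * g) = lam h + Λ g, KΛ, hKΛ : IsOpen KΛ, hΛK : Λ (x * κ) = Λ x)` of ★ `Representation.exists_deformationPair_of_height` ∕
`Representation.exists_linearEquiv_smoothInd_unipotentModel_jet`.  Seat F0P3b-p01 (g25).

THE MATHEMATICS.  `G = U(Φ_N)(L⁺_v) = ↥(unitaryGroupOfForm (conjLocal L c v) (cmLocalForm L N v))` (= ★ `(cmDatum L N Φ_N).Local v`, `rfl`), `B = TN = (cmBorelTriple L N v).P`,
`T = torusU`, `K_v = cmLocalIntegralLevel L N Φ_N v` (compact open, ★ `isCompact_isOpen_cmLocalIntegralLevel`).  By IWASAWA `G = B·K_v` (★ `exists_borel_mul_mem_cmLocalIntegralLevel`, EVERY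
finite `v`) and `proj(B ∩ K_v) ⊆ T ∩ K_v` (★ `proj_mem_cmLocalIntegralLevel`), the generic construction of FILE H1 (`Literature.GroupTheory.exists_height_of_mul_decomposition_of_isOpen`)
gives, for every additive `λ : T → A` trivial on `T ∩ K_v`, the HEIGHT `Λ(b κ) := λ(proj b)` — NO Iwasawa exponents ★ `iwasawaExp` (which need an unramified datum), no compact picture.
The canonical instances: `λ_{i,w}(t) := ord_w(t_ii) = log (Valued.v ((t_ii)_w))` (`i : Fin N`, `w ∣ v`; additive by `map_mul` + `WithZero.log_mul`, trivial on `T ∩ K_v` because there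
`Valued.v ((t_ii)_w) = 1`, ★ `v_torusEntry_eq_one_of_mem_cmLocalIntegralLevel`) — the derivative at `s = 0` of the unramified twist `ν^s = |a(·)|_w^s` up to the immaterial factor `−log q_w`
(★ `LocallyConstantAdditiveCompact.additive_eq_smul_additive_of_rescale`), i.e. the `lam` of the UNIPOTENT MODEL `N_χ` (★ `CharacterSelfExtensionModel`) of census (α).
* §1 **`exists_height_cmBorel`** — any additive `λ` on `T` killed by `T ∩ K_v` ⇒ `∃ Λ` with J1's letters + `Λ|_{K_v} = 0` + `IsLocallyConstant Λ`; `height_cmBorel_unique`.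
* §2 `ordEntry_mul`, `ordEntry_eq_zero_of_mem` and **`exists_height_cmBorel_ordEntry`** (`A = ℤ`) ∕ **`exists_height_cmBorel_ordEntry_cast`** (any ring `k`, e.g. `ℂ`: J1's `k`).
[cite: Casselman1995, §3.1] [cite: BernsteinZelevinsky1977, §1.9, §2.3] [cite: Rogawski1990, §4.5 p. 45; §12.2 p. 173] [cite: CartierCorvallis1979, §IV.1]
HONEST LABEL: count-neutral datum helper (the (A4) input «`A` does not deform to first order» of rows 21∕26 stays PRINT [Keys1984]); h413 OPEN; HC_CM is proved only modulo the
7 printed citations (2 remaining named inputs hLiu418 = stmt-HodgeConjecture-24832, h413 = stmt-HodgeConjecture-24833) until rung 0 closes.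

## References
* [Casselman1995] W. Casselman, *Introduction to the theory of admissible representations of p-adic reductive groups* (1995), §3.1.
* [BernsteinZelevinsky1977] I. N. Bernstein, A. V. Zelevinsky, *Induced representations of reductive p-adic groups I*, Ann. Sci. ÉNS 10 (1977), §1.9, §2.3.
* [Rogawski1990] J. D. Rogawski, *Automorphic Representations of Unitary Groups in Three Variables*, Ann. of Math. Stud. 123 (1990), §4.5 p. 45, §12.2 p. 173.
* [CartierCorvallis1979] P. Cartier, *Representations of p-adic groups: a survey*, Proc. Symp. Pure Math. 33 (1979), part 1, §IV.1.
-/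

set_option autoImplicit false

set_option linter.dupNamespace false

noncomputable section

open NumberField IsDedekindDomain

namespace Summit.HodgeConjecture.HodgeConjecture.Cruxes.H413.F0P3cStCharTSHeightAtDatum

open Literature.NumberTheory.Automorphic Literature.NumberTheory.Automorphic.UnitaryGroup

variable (L : Type) [Field L] [NumberField L] [IsCMField L] (N : ℕ) (v : HeightOneSpectrum (𝓞 ↥(maximalRealSubfield L)))

/-! ## §1 The height for an arbitrary additive `λ` on the torus killed by `T ∩ K_v` -/

/-- **THE IWASAWA HEIGHT AT THE CM DATUM** (every `N`, every finite place `v` of `L⁺`).  For an additive `λ : T → A` (`λ(s s') = λ s + λ s'`) with `λ = 0` on `T ∩ K_v`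
there is `Λ : G → A` with `Λ (b g) = λ(proj b) + Λ g` (`b ∈ B`), `Λ (x κ) = Λ x` and `Λ κ = 0` (`κ ∈ K_v`), and `Λ` is locally constant — the letters
`(Λ, hΛ, KΛ := K_v, hKΛ, hΛK)` of ★ `Representation.exists_deformationPair_of_height` with `lam := λ ∘ proj`.  (`G = B·K_v` ★ + `proj(B ∩ K_v) ⊆ K_v` ★ + FILE H1.)
[cite: Casselman1995, §3.1] [cite: Rogawski1990, §4.5 p. 45] [cite: CartierCorvallis1979, §IV.1] -/
theorem exists_height_cmBorel {A : Type*} [AddCommGroup A]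
    (lam : ↥(torusU (conjLocal L (IsCMField.complexConj L) v) (cmLocalForm L N v)) → A)
    (hmul : ∀ s s', lam (s * s') = lam s + lam s')
    (hK : ∀ s : ↥(torusU (conjLocal L (IsCMField.complexConj L) v) (cmLocalForm L N v)),
      (s : ↥(unitaryGroupOfForm (conjLocal L (IsCMField.complexConj L) v) (cmLocalForm L N v))) ∈
        cmLocalIntegralLevel L N (Matrix.of fun i j : Fin N => if i.val + j.val + 1 = N then (1 : L) else 0) v → lam s = 0) :
    ∃ Λ : ↥(unitaryGroupOfForm (conjLocal L (IsCMField.complexConj L) v) (cmLocalForm L N v)) → A,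
      (∀ (b : ↥(cmBorelTriple L N v).P) (g : ↥(unitaryGroupOfForm (conjLocal L (IsCMField.complexConj L) v) (cmLocalForm L N v))),
          Λ ((b : ↥(unitaryGroupOfForm (conjLocal L (IsCMField.complexConj L) v) (cmLocalForm L N v))) * g) = lam ((cmBorelTriple L N v).proj b) + Λ g) ∧
      (∀ (x κ : ↥(unitaryGroupOfForm (conjLocal L (IsCMField.complexConj L) v) (cmLocalForm L N v))),
          κ ∈ cmLocalIntegralLevel L N (Matrix.of fun i j : Fin N => if i.val + j.val + 1 = N then (1 : L) else 0) v → Λ (x * κ) = Λ x) ∧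
      (∀ κ : ↥(unitaryGroupOfForm (conjLocal L (IsCMField.complexConj L) v) (cmLocalForm L N v)),
          κ ∈ cmLocalIntegralLevel L N (Matrix.of fun i j : Fin N => if i.val + j.val + 1 = N then (1 : L) else 0) v → Λ κ = 0) ∧
      IsLocallyConstant Λ := by
  have iTG : IsTopologicalGroup ↥(unitaryGroupOfForm (conjLocal L (IsCMField.complexConj L) v) (cmLocalForm L N v)) := inferInstance
  have iCM : ContinuousMul ↥(unitaryGroupOfForm (conjLocal L (IsCMField.complexConj L) v) (cmLocalForm L N v)) :=
    IsTopologicalGroup.toContinuousMul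
  have hKo := (isCompact_isOpen_cmLocalIntegralLevel L N (Matrix.of fun i j : Fin N => if i.val + j.val + 1 = N then (1 : L) else 0) v).2
  have hGK : ∀ g : ↥(unitaryGroupOfForm (conjLocal L (IsCMField.complexConj L) v) (cmLocalForm L N v)),
      ∃ h : ↥(cmBorelTriple L N v).P, ∃ κ : ↥(unitaryGroupOfForm (conjLocal L (IsCMField.complexConj L) v) (cmLocalForm L N v)),
        κ ∈ cmLocalIntegralLevel L N (Matrix.of fun i j : Fin N => if i.val + j.val + 1 = N then (1 : L) else 0) v ∧
          g = (h : ↥(unitaryGroupOfForm (conjLocal L (IsCMField.complexConj L) v) (cmLocalForm L N v))) * κ :=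
    exists_borel_mul_mem_cmLocalIntegralLevel L N v
  exact @Literature.GroupTheory.exists_height_of_mul_decomposition_of_isOpen _ _ _ iCM (cmBorelTriple L N v).P
    (cmLocalIntegralLevel L N (Matrix.of fun i j : Fin N => if i.val + j.val + 1 = N then (1 : L) else 0) v) hKo hGK _ _
    (fun b => lam ((cmBorelTriple L N v).proj b)) (fun b b' => by rw [map_mul, hmul])
    (fun b hb => hK _ (proj_mem_cmLocalIntegralLevel L N v b hb))

/-- **UNIQUENESS OF THE HEIGHT**: `Λ (b g) = λ(proj b) + Λ g` and `Λ|_{K_v} = 0` determine `Λ` (Iwasawa). [cite: Casselman1995, §3.1] [cite: Rogawski1990, §4.5 p. 45] -/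
theorem height_cmBorel_unique {A : Type*} [AddCommGroup A]
    (lam : ↥(torusU (conjLocal L (IsCMField.complexConj L) v) (cmLocalForm L N v)) → A)
    {Λ Λ' : ↥(unitaryGroupOfForm (conjLocal L (IsCMField.complexConj L) v) (cmLocalForm L N v)) → A}
    (hΛ : ∀ (b : ↥(cmBorelTriple L N v).P) (g : ↥(unitaryGroupOfForm (conjLocal L (IsCMField.complexConj L) v) (cmLocalForm L N v))),
      Λ ((b : ↥(unitaryGroupOfForm (conjLocal L (IsCMField.complexConj L) v) (cmLocalForm L N v))) * g) = lam ((cmBorelTriple L N v).proj b) + Λ g)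
    (hΛK : ∀ κ : ↥(unitaryGroupOfForm (conjLocal L (IsCMField.complexConj L) v) (cmLocalForm L N v)),
      κ ∈ cmLocalIntegralLevel L N (Matrix.of fun i j : Fin N => if i.val + j.val + 1 = N then (1 : L) else 0) v → Λ κ = 0)
    (hΛ' : ∀ (b : ↥(cmBorelTriple L N v).P) (g : ↥(unitaryGroupOfForm (conjLocal L (IsCMField.complexConj L) v) (cmLocalForm L N v))),
      Λ' ((b : ↥(unitaryGroupOfForm (conjLocal L (IsCMField.complexConj L) v) (cmLocalForm L N v))) * g) = lam ((cmBorelTriple L N v).proj b) + Λ' g)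
    (hΛ'K : ∀ κ : ↥(unitaryGroupOfForm (conjLocal L (IsCMField.complexConj L) v) (cmLocalForm L N v)),
      κ ∈ cmLocalIntegralLevel L N (Matrix.of fun i j : Fin N => if i.val + j.val + 1 = N then (1 : L) else 0) v → Λ' κ = 0) :
    Λ = Λ' :=
  Literature.GroupTheory.height_unique_of_mul_decomposition (cmBorelTriple L N v).P
    (cmLocalIntegralLevel L N (Matrix.of fun i j : Fin N => if i.val + j.val + 1 = N then (1 : L) else 0) v)
    (exists_borel_mul_mem_cmLocalIntegralLevel L N v) (fun b => lam ((cmBorelTriple L N v).proj b)) hΛ hΛK hΛ' hΛ'K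

/-! ## §2 The `ord_w` instances `λ_{i,w}(t) = log (Valued.v ((t_ii)_w))` -/

/-- **`ord_w` OF A TORUS COORDINATE IS ADDITIVE**: `log v((s s')_ii,w) = log v(s_ii,w) + log v(s'_ii,w)` (units have non-zero valuation; `torusEntry` is a homomorphism,
`Valued.v` multiplicative, `WithZero.log_mul`). [cite: Rogawski1990, §12.2 p. 173] -/
theorem ordEntry_mul (i : Fin N) (w : PlacesOver L v)
    (s s' : ↥(torusU (conjLocal L (IsCMField.complexConj L) v) (cmLocalForm L N v))) :
    WithZero.log (Valued.v ((((torusEntry (conjLocal L (IsCMField.complexConj L) v) (cmLocalForm L N v) i (s * s') : (LocalRing L v)ˣ) :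
        LocalRing L v)) w)) =
      WithZero.log (Valued.v ((((torusEntry (conjLocal L (IsCMField.complexConj L) v) (cmLocalForm L N v) i s : (LocalRing L v)ˣ) :
        LocalRing L v)) w)) +
      WithZero.log (Valued.v ((((torusEntry (conjLocal L (IsCMField.complexConj L) v) (cmLocalForm L N v) i s' : (LocalRing L v)ˣ) :
        LocalRing L v)) w)) := by
  have hne : ∀ u : (LocalRing L v)ˣ, Valued.v (((u : LocalRing L v)) w) ≠ 0 := fun u => by
    refine (Valuation.ne_zero_iff _).2 fun h0 => ?_
    have h1 : ((u : LocalRing L v) * ((u⁻¹ : (LocalRing L v)ˣ) : LocalRing L v)) w = 1 := by rw [Units.mul_inv]; rfl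
    rw [Pi.mul_apply, h0, zero_mul] at h1
    exact zero_ne_one h1
  rw [map_mul, Units.val_mul, Pi.mul_apply, map_mul, WithZero.log_mul (hne _) (hne _)]

/-- **`ord_w` OF A TORUS COORDINATE VANISHES ON `T ∩ K_v`** (★ `v_torusEntry_eq_one_of_mem_cmLocalIntegralLevel`: there `Valued.v = 1`, and `log 1 = 0`).
[cite: Rogawski1990, §12.1 p. 171; §4.5 p. 45] [cite: CartierCorvallis1979, §IV.1] -/
theorem ordEntry_eq_zero_of_mem (i : Fin N) (w : PlacesOver L v)
    (s : ↥(torusU (conjLocal L (IsCMField.complexConj L) v) (cmLocalForm L N v)))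
    (hs : (s : ↥(unitaryGroupOfForm (conjLocal L (IsCMField.complexConj L) v) (cmLocalForm L N v))) ∈
      cmLocalIntegralLevel L N (Matrix.of fun i j : Fin N => if i.val + j.val + 1 = N then (1 : L) else 0) v) :
    WithZero.log (Valued.v ((((torusEntry (conjLocal L (IsCMField.complexConj L) v) (cmLocalForm L N v) i s : (LocalRing L v)ˣ) :
        LocalRing L v)) w)) = 0 := by
  rw [v_torusEntry_eq_one_of_mem_cmLocalIntegralLevel L N v s hs i w, WithZero.log_one]

/-- **THE `ord_w`-HEIGHT** `Λ_{i,w} : G → ℤ`: `Λ(b g) = ord_w((proj b)_ii) + Λ(g)`, right-`K_v`-invariant, `0` on `K_v`, locally constant (§1 at `λ_{i,w}`).  For `N = 3`, `i = 0` this is the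
Iwasawa height `ord_w(a(b))` whose scalar multiples are ALL the locally constant additive functions on `T` trivial on `T_c` (★ `additive_eq_zsmul_of_eq_zero_on_open`), in particular the
derivative of `ν^s`. [cite: Casselman1995, §3.1] [cite: BernsteinZelevinsky1977, §2.3] [cite: Rogawski1990, §12.2 p. 173] -/
theorem exists_height_cmBorel_ordEntry (i : Fin N) (w : PlacesOver L v) :
    ∃ Λ : ↥(unitaryGroupOfForm (conjLocal L (IsCMField.complexConj L) v) (cmLocalForm L N v)) → ℤ,
      (∀ (b : ↥(cmBorelTriple L N v).P) (g : ↥(unitaryGroupOfForm (conjLocal L (IsCMField.complexConj L) v) (cmLocalForm L N v))),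
          Λ ((b : ↥(unitaryGroupOfForm (conjLocal L (IsCMField.complexConj L) v) (cmLocalForm L N v))) * g) =
            WithZero.log (Valued.v ((((torusEntry (conjLocal L (IsCMField.complexConj L) v) (cmLocalForm L N v) i ((cmBorelTriple L N v).proj b) :
              (LocalRing L v)ˣ) : LocalRing L v)) w)) + Λ g) ∧
      (∀ (x κ : ↥(unitaryGroupOfForm (conjLocal L (IsCMField.complexConj L) v) (cmLocalForm L N v))),
          κ ∈ cmLocalIntegralLevel L N (Matrix.of fun i j : Fin N => if i.val + j.val + 1 = N then (1 : L) else 0) v → Λ (x * κ) = Λ x) ∧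
      (∀ κ : ↥(unitaryGroupOfForm (conjLocal L (IsCMField.complexConj L) v) (cmLocalForm L N v)),
          κ ∈ cmLocalIntegralLevel L N (Matrix.of fun i j : Fin N => if i.val + j.val + 1 = N then (1 : L) else 0) v → Λ κ = 0) ∧
      IsLocallyConstant Λ :=
  exists_height_cmBorel L N v _ (ordEntry_mul L N v i w) (ordEntry_eq_zero_of_mem L N v i w)

/-- **THE `ord_w`-HEIGHT WITH VALUES IN A RING `k`** (`k = ℂ` for ★ J1 `exists_deformationPair_of_height` ∕ `exists_linearEquiv_smoothInd_unipotentModel_jet`): the same statement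
for `λ_{i,w}` cast into `k`. [cite: Casselman1995, §3.1] [cite: BernsteinZelevinsky1977, §2.3] [cite: Rogawski1990, §12.2 p. 173] -/
theorem exists_height_cmBorel_ordEntry_cast (k : Type*) [Ring k] (i : Fin N) (w : PlacesOver L v) :
    ∃ Λ : ↥(unitaryGroupOfForm (conjLocal L (IsCMField.complexConj L) v) (cmLocalForm L N v)) → k,
      (∀ (b : ↥(cmBorelTriple L N v).P) (g : ↥(unitaryGroupOfForm (conjLocal L (IsCMField.complexConj L) v) (cmLocalForm L N v))),
          Λ ((b : ↥(unitaryGroupOfForm (conjLocal L (IsCMField.complexConj L) v) (cmLocalForm L N v))) * g) =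
            ((WithZero.log (Valued.v ((((torusEntry (conjLocal L (IsCMField.complexConj L) v) (cmLocalForm L N v) i ((cmBorelTriple L N v).proj b) :
              (LocalRing L v)ˣ) : LocalRing L v)) w)) : ℤ) : k) + Λ g) ∧
      (∀ (x κ : ↥(unitaryGroupOfForm (conjLocal L (IsCMField.complexConj L) v) (cmLocalForm L N v))),
          κ ∈ cmLocalIntegralLevel L N (Matrix.of fun i j : Fin N => if i.val + j.val + 1 = N then (1 : L) else 0) v → Λ (x * κ) = Λ x) ∧
      (∀ κ : ↥(unitaryGroupOfForm (conjLocal L (IsCMField.complexConj L) v) (cmLocalForm L N v)),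
          κ ∈ cmLocalIntegralLevel L N (Matrix.of fun i j : Fin N => if i.val + j.val + 1 = N then (1 : L) else 0) v → Λ κ = 0) ∧
      IsLocallyConstant Λ := by
  obtain ⟨Λ, h1, h2, h3, h4⟩ := exists_height_cmBorel_ordEntry L N v i w
  refine ⟨fun g => ((Λ g : ℤ) : k), fun b g => ?_, fun x κ hκ => ?_, fun κ hκ => ?_, ?_⟩
  · show ((Λ (_ * g) : ℤ) : k) = _
    rw [h1, Int.cast_add]
  · show ((Λ (x * κ) : ℤ) : k) = ((Λ x : ℤ) : k)
    rw [h2 x κ hκ]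
  · show ((Λ κ : ℤ) : k) = 0
    rw [h3 κ hκ, Int.cast_zero]
  · exact h4.comp (fun z : ℤ => (z : k))

end Summit.HodgeConjecture.HodgeConjecture.Cruxes.H413.F0P3cStCharTSHeightAtDatum

end
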